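import Mathlib.Analysis.SpecialFunctions.BinaryEntropy
import Summits.PneNP.PneNP.Theorems.SzkEntropyPeaThreeNotInPStubJSD
import HarnessLib

/-!
# Route SzkEntropy, crux `PeaThreeNotInP` (stmt-PneNP-10776), line `SketchIdeator3`, socket rider:
# the overlap upper bound for the entropy of a fair mixture (registered stub `stub_mixture_entropy_le`)

Companion of the Jensen–Shannon accounting lemma `TensorIsoLine.mixture_entropy_ge`
(`Theorems/SzkEntropyPeaThreeNotInPStubJSD.lean`, the LOWER bound `(H f + H g)/2 + π ≤ H(mix)`
under a disjointness event of mass `π`).  Here the UPPER bound by the overlap: for two maps `f, g`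
on the same uniform sample space of size `N` and their fair mixture
`mix (b, i) = if b then f i else g i` on `Bool × ι`,

  `H(mix) ≤ (H f + H g)/2 + 1 - (∑_y min(|f⁻¹ y|, |g⁻¹ y|)) / N`

(`mixture_entropy_le`, `stub_mixture_entropy_le`), i.e. the Jensen–Shannon divergence of the two
image distributions is at most their total-variation distance `1 - ∑_y min(p_y, q_y)`.  The gate
compiles certified one-bit entropy gaps of branching-program samplers through this bound.

Proof: with `A y = |f⁻¹ y|`, `B y = |g⁻¹ y|` the mixture's fibre over `y` has `A y + B y` points,
and regrouping the defining sums by the value `y` (exactly as in `mixture_entropy_ge`) gives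
`2N · (H(mix) - (H f + H g)/2) = ∑_y [A log₂ (2A/(A+B)) + B log₂ (2B/(A+B))]`; the summand is
`(A+B)(1 - h₂(A/(A+B)))` with `h₂` the binary entropy in bits, and `h₂(p) ≥ 2 min(p, 1-p)` on
`[0,1]` (concavity of `h₂`, `h₂ 0 = h₂ 1 = 0`, `h₂ (1/2) = 1`; Mathlib's
`Real.strictConcave_binEntropy`) gives the termwise bound
`A log₂ (2A/(A+B)) + B log₂ (2B/(A+B)) ≤ A + B - 2 min(A, B)` (`termwise_le`); summing,
`∑_y (A y + B y) = 2N`.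

References: J. Lin, *Divergence measures based on the Shannon entropy*, IEEE Trans. Inform.
Theory 37 (1991), Thm 3–4 (`JS ≤ V/2` in bits); T. Cover, J. Thomas, *Elements of Information
Theory*, 2nd ed., §2.7.
-/

noncomputable section

open Finset
open Literature.InformationTheory.Entropy
open Summit.PneNP.PneNP.Cruxes.PeaThreeNotInP.TensorIsoLine

namespace Summit.PneNP.PneNP.Cruxes.PeaThreeNotInP.SocketBP

set_option linter.dupNamespace false -- `Summit.PneNP.PneNP.…`: summit = sub-problem name (D-0017)

/-- **Binary entropy dominates the tent**: `2 log 2 · min(p, 1 - p) ≤ h(p)` for `p ∈ [0,1]`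
(natural-log binary entropy `Real.binEntropy`; concavity with `h 0 = h 1 = 0`, `h (1/2) = log 2`).
[folklore] -/
theorem two_mul_log_two_mul_min_le_binEntropy {p : ℝ} (hp₀ : 0 ≤ p) (hp₁ : p ≤ 1) :
    2 * Real.log 2 * min p (1 - p) ≤ Real.binEntropy p := by
  have key : ∀ {q : ℝ}, 0 ≤ q → q ≤ 2⁻¹ → 2 * Real.log 2 * q ≤ Real.binEntropy q := by
    intro q hq₀ hq₁
    have hx : (0 : ℝ) ∈ Set.Icc (0 : ℝ) 1 := Set.left_mem_Icc.2 zero_le_one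
    have hy : (2⁻¹ : ℝ) ∈ Set.Icc (0 : ℝ) 1 := Set.mem_Icc.2 ⟨by norm_num, by norm_num⟩
    have hc := Real.strictConcave_binEntropy.concaveOn.2 hx hy
      (show (0 : ℝ) ≤ 1 - 2 * q by linarith) (show (0 : ℝ) ≤ 2 * q by linarith) (by ring)
    simp only [smul_eq_mul, mul_zero, zero_add, Real.binEntropy_zero, Real.binEntropy_two_inv]
      at hc
    have h2 : (2 : ℝ) * q * 2⁻¹ = q := by ring
    rw [h2] at hc
    linarith
  rcases le_total p 2⁻¹ with h | h
  · rw [min_eq_left (by linarith)]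
    exact key hp₀ h
  · rw [min_eq_right (by linarith), ← Real.binEntropy_one_sub]
    exact key (by linarith) (by linarith)

/-- **Termwise overlap bound** (two-point Jensen–Shannon vs. total variation):
`a log₂ (2a/(a+b)) + b log₂ (2b/(a+b)) ≤ a + b - 2 min(a, b)` for `a, b ≥ 0`, `a + b > 0`, with
Lean's junk conventions at `a = 0` or `b = 0` (where it is the equality `b = b`, resp. `a = a`).
For `a, b > 0` it is `(a+b)(1 - h₂(a/(a+b))) ≤ (a+b)(1 - 2 min(p, 1-p))`, `p = a/(a+b)`.
[J. Lin, IEEE Trans. Inform. Theory 37 (1991), Thm 3] [folklore] -/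
theorem termwise_le {a b : ℝ} (ha : 0 ≤ a) (hb : 0 ≤ b) (hab : 0 < a + b) :
    a * Real.logb 2 (2 * a / (a + b)) + b * Real.logb 2 (2 * b / (a + b)) ≤
      a + b - 2 * min a b := by
  rcases ha.eq_or_lt with rfl | ha'
  · have hb' : 0 < b := by simpa using hab
    rw [termwise_eq_right hb', min_eq_left hb'.le]
    linarith
  rcases hb.eq_or_lt with rfl | hb'
  · rw [termwise_eq_left ha', min_eq_right ha'.le]
    linarith
  have hlog2 : 0 < Real.log 2 := Real.log_pos one_lt_two
  have hab' : a + b ≠ 0 := hab.ne'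
  set p : ℝ := a / (a + b) with hp
  have hp₀ : 0 ≤ p := div_nonneg ha hab.le
  have hp₁ : p ≤ 1 := div_le_one_of_le₀ (by linarith) hab.le
  have hq : 1 - p = b / (a + b) := by
    rw [hp]
    field_simp
    ring
  have hmin : (a + b) * min p (1 - p) = min a b := by
    rw [hq, hp, min_div_div_right hab.le]
    field_simp
  have hent : (a + b) * Real.binEntropy p =
      (a + b) * Real.log (a + b) - a * Real.log a - b * Real.log b := by
    rw [Real.binEntropy, hq, hp, Real.log_inv, Real.log_inv, Real.log_div ha'.ne' hab',
      Real.log_div hb'.ne' hab']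
    field_simp
    ring
  have hkey : 2 * Real.log 2 * min a b ≤
      (a + b) * Real.log (a + b) - a * Real.log a - b * Real.log b := by
    have h := mul_le_mul_of_nonneg_left (two_mul_log_two_mul_min_le_binEntropy hp₀ hp₁) hab.le
    calc 2 * Real.log 2 * min a b = (a + b) * (2 * Real.log 2 * min p (1 - p)) := by
          rw [← hmin]; ring
      _ ≤ (a + b) * Real.binEntropy p := h
      _ = _ := hent
  have e1 : Real.logb 2 (2 * a / (a + b)) =
      (Real.log 2 + Real.log a - Real.log (a + b)) / Real.log 2 := by
    rw [Real.logb, Real.log_div (by positivity) hab', Real.log_mul two_ne_zero ha'.ne']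
  have e2 : Real.logb 2 (2 * b / (a + b)) =
      (Real.log 2 + Real.log b - Real.log (a + b)) / Real.log 2 := by
    rw [Real.logb, Real.log_div (by positivity) hab', Real.log_mul two_ne_zero hb'.ne']
  have e3 : a * ((Real.log 2 + Real.log a - Real.log (a + b)) / Real.log 2) +
      b * ((Real.log 2 + Real.log b - Real.log (a + b)) / Real.log 2) =
      (a + b) - ((a + b) * Real.log (a + b) - a * Real.log a - b * Real.log b) / Real.log 2 := by
    field_simp
    ring
  rw [e1, e2, e3]
  have h4 : 2 * min a b ≤
      ((a + b) * Real.log (a + b) - a * Real.log a - b * Real.log b) / Real.log 2 := by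
    rw [le_div_iff₀ hlog2]
    linarith
  linarith

variable {ι β : Type*} [Fintype ι] [DecidableEq β]

/-- **Overlap upper bound for the entropy of a fair mixture** (Jensen–Shannon divergence is at
most the total-variation distance): for `f, g : ι → β` on the uniform sample space of size
`N = |ι|` and the fair mixture `mix (b, i) = if b then f i else g i`,
`H(mix) ≤ (H f + H g)/2 + 1 - (∑_{y ∈ f(ι)} min(|f⁻¹ y|, |g⁻¹ y|)) / N`.
[J. Lin, IEEE Trans. Inform. Theory 37 (1991), Thm 3–4] [folklore] -/
theorem mixture_entropy_le [Nonempty ι] (f g : ι → β) :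
    mapEntropy (Finset.univ : Finset (Bool × ι)) (fun p => if p.1 then f p.2 else g p.2) ≤
      (mapEntropy Finset.univ f + mapEntropy Finset.univ g) / 2 + 1 -
        (∑ y ∈ Finset.univ.image f,
          (min (Finset.univ.filter fun i => f i = y).card
            (Finset.univ.filter fun i => g i = y).card : ℝ)) / Fintype.card ι := by
  classical
  set m : Bool × ι → β := fun p => if p.1 then f p.2 else g p.2 with hm
  set N : ℝ := (Fintype.card ι : ℝ) with hNdef
  have hN : 0 < N := by
    rw [hNdef]; exact_mod_cast Fintype.card_pos
  set A : β → ℝ := fun y => ((fiber (univ : Finset ι) f y).card : ℝ) with hadef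
  set B : β → ℝ := fun y => ((fiber (univ : Finset ι) g y).card : ℝ) with hbdef
  have ha_nn : ∀ y, 0 ≤ A y := fun y => by rw [hadef]; positivity
  have hb_nn : ∀ y, 0 ≤ B y := fun y => by rw [hbdef]; positivity
  have ha_pos : ∀ i, 0 < A (f i) := fun i => by
    simp only [hadef]; exact_mod_cast card_fiber_pos f (mem_univ i)
  have hb_pos : ∀ j, 0 < B (g j) := fun j => by
    simp only [hbdef]; exact_mod_cast card_fiber_pos g (mem_univ j)
  have ha_zero_iff : ∀ y, A y = 0 ↔ y ∉ univ.image f := fun y => by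
    simp only [hadef, Nat.cast_eq_zero]; exact card_fiber_univ_eq_zero_iff f y
  have hb_zero_iff : ∀ y, B y = 0 ↔ y ∉ univ.image g := fun y => by
    simp only [hbdef, Nat.cast_eq_zero]; exact card_fiber_univ_eq_zero_iff g y
  have hfib : ∀ y, ((fiber (univ : Finset (Bool × ι)) m y).card : ℝ) = A y + B y := by
    intro y
    simp only [hadef, hbdef, fiber, Finset.card_filter, Fintype.sum_prod_type, Fintype.sum_bool,
      hm]
    push_cast
    simp
  have hcard : (((univ : Finset (Bool × ι)).card : ℕ) : ℝ) = 2 * N := by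
    rw [Finset.card_univ, Fintype.card_prod, Fintype.card_bool, hNdef]
    push_cast
    ring
  have Hm : mapEntropy (univ : Finset (Bool × ι)) m =
      ((∑ i, Real.logb 2 (2 * N / (A (f i) + B (f i)))) +
        ∑ i, Real.logb 2 (2 * N / (A (g i) + B (g i)))) / (2 * N) := by
    unfold mapEntropy
    rw [hcard]
    congr 1
    rw [Fintype.sum_prod_type, Fintype.sum_bool]
    congr 1
    · refine Finset.sum_congr rfl fun i _ => ?_
      rw [hfib]
      simp [hm]
    · refine Finset.sum_congr rfl fun i _ => ?_
      rw [hfib]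
      simp [hm]
  have Hf : mapEntropy (univ : Finset ι) f = (∑ i, Real.logb 2 (N / A (f i))) / N := by
    simp only [mapEntropy, Finset.card_univ, hNdef, hadef]
  have Hg : mapEntropy (univ : Finset ι) g = (∑ i, Real.logb 2 (N / B (g i))) / N := by
    simp only [mapEntropy, Finset.card_univ, hNdef, hbdef]
  have hquot : ∀ {p q : ℝ}, 0 < p → 0 ≤ q →
      Real.logb 2 (2 * N / (p + q)) - Real.logb 2 (N / p) = Real.logb 2 (2 * p / (p + q)) := by
    intro p q hc hd
    have hcd : 0 < p + q := by linarith
    rw [← Real.logb_div (by positivity) (by positivity)]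
    congr 1
    field_simp
  set u : β → ℝ := fun y => Real.logb 2 (2 * A y / (A y + B y)) with hudef
  set v : β → ℝ := fun y => Real.logb 2 (2 * B y / (A y + B y)) with hvdef
  have hM : (∑ y ∈ Finset.univ.image f,
      (min (Finset.univ.filter fun i => f i = y).card
        (Finset.univ.filter fun i => g i = y).card : ℝ)) =
      ∑ y ∈ univ.image f, min (A y) (B y) :=
    Finset.sum_congr rfl fun _ _ => rfl
  have hgoal : (∑ i, Real.logb 2 (2 * N / (A (f i) + B (f i)))) +
        ∑ i, Real.logb 2 (2 * N / (A (g i) + B (g i))) ≤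
      (∑ i, Real.logb 2 (N / A (f i))) + (∑ i, Real.logb 2 (N / B (g i))) + 2 * N -
        2 * ∑ y ∈ univ.image f, min (A y) (B y) := by
    have hDf : ∑ i, Real.logb 2 (2 * N / (A (f i) + B (f i))) - ∑ i, Real.logb 2 (N / A (f i)) =
        ∑ i, u (f i) := by
      rw [← Finset.sum_sub_distrib]
      refine Finset.sum_congr rfl fun i _ => ?_
      rw [hudef]
      exact hquot (ha_pos i) (hb_nn _)
    have hDg : ∑ i, Real.logb 2 (2 * N / (A (g i) + B (g i))) - ∑ i, Real.logb 2 (N / B (g i)) =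
        ∑ i, v (g i) := by
      rw [← Finset.sum_sub_distrib]
      refine Finset.sum_congr rfl fun i _ => ?_
      have := hquot (hb_pos i) (ha_nn (g i))
      rw [add_comm (B (g i)) (A (g i))] at this
      rw [this]
    set Y : Finset β := univ.image f ∪ univ.image g with hYdef
    have hregf : ∑ i, u (f i) = ∑ y ∈ Y, A y * u y := by
      rw [Finset.sum_comp u f]
      have : ∑ y ∈ univ.image f, (univ.filter fun i => f i = y).card • u y =
          ∑ y ∈ univ.image f, A y * u y := by
        refine Finset.sum_congr rfl fun y _ => ?_
        rw [nsmul_eq_mul, hadef]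
        rfl
      rw [this]
      refine Finset.sum_subset Finset.subset_union_left fun y _ hy => ?_
      rw [(ha_zero_iff y).2 hy, zero_mul]
    have hregg : ∑ i, v (g i) = ∑ y ∈ Y, B y * v y := by
      rw [Finset.sum_comp v g]
      have : ∑ y ∈ univ.image g, (univ.filter fun i => g i = y).card • v y =
          ∑ y ∈ univ.image g, B y * v y := by
        refine Finset.sum_congr rfl fun y _ => ?_
        rw [nsmul_eq_mul, hbdef]
        rfl
      rw [this]
      refine Finset.sum_subset Finset.subset_union_right fun y _ hy => ?_
      rw [(hb_zero_iff y).2 hy, zero_mul]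
    have hYpos : ∀ y ∈ Y, 0 < A y + B y := by
      intro y hy
      rw [hYdef, Finset.mem_union] at hy
      rcases hy with hy | hy
      · have h1 : A y ≠ 0 := fun h => (ha_zero_iff y).1 h hy
        have h2 := ha_nn y
        have h3 := hb_nn y
        have h4 : 0 < A y := lt_of_le_of_ne h2 (Ne.symm h1)
        linarith
      · have h1 : B y ≠ 0 := fun h => (hb_zero_iff y).1 h hy
        have h2 := ha_nn y
        have h3 := hb_nn y
        have h4 : 0 < B y := lt_of_le_of_ne h3 (Ne.symm h1)
        linarith
    have hsumA : ∑ y ∈ Y, A y = N := by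
      have h1 : ∑ y ∈ univ.image f, A y = N := by
        rw [hNdef, ← Finset.card_univ, Finset.card_eq_sum_card_image f univ]
        push_cast
        rfl
      rw [← h1]
      symm
      refine Finset.sum_subset Finset.subset_union_left fun y _ hy => ?_
      exact (ha_zero_iff y).2 hy
    have hsumB : ∑ y ∈ Y, B y = N := by
      have h1 : ∑ y ∈ univ.image g, B y = N := by
        rw [hNdef, ← Finset.card_univ, Finset.card_eq_sum_card_image g univ]
        push_cast
        rfl
      rw [← h1]
      symm
      refine Finset.sum_subset Finset.subset_union_right fun y _ hy => ?_
      exact (hb_zero_iff y).2 hy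
    have hsumMin : ∑ y ∈ Y, min (A y) (B y) = ∑ y ∈ univ.image f, min (A y) (B y) := by
      symm
      refine Finset.sum_subset Finset.subset_union_left fun y _ hy => ?_
      rw [(ha_zero_iff y).2 hy]
      exact min_eq_left (hb_nn y)
    have hterm : ∀ y ∈ Y, A y * u y + B y * v y ≤ A y + B y - 2 * min (A y) (B y) :=
      fun y hy => termwise_le (ha_nn y) (hb_nn y) (hYpos y hy)
    have hD : ∑ i, u (f i) + ∑ i, v (g i) ≤
        2 * N - 2 * ∑ y ∈ univ.image f, min (A y) (B y) := by
      rw [hregf, hregg, ← Finset.sum_add_distrib, ← hsumMin]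
      calc ∑ y ∈ Y, (A y * u y + B y * v y)
          ≤ ∑ y ∈ Y, (A y + B y - 2 * min (A y) (B y)) := Finset.sum_le_sum hterm
        _ = 2 * N - 2 * ∑ y ∈ Y, min (A y) (B y) := by
          rw [Finset.sum_sub_distrib, Finset.sum_add_distrib, ← Finset.mul_sum, hsumA, hsumB]
          ring
    linarith [hDf, hDg, hD]
  rw [Hm, Hf, Hg, hM]
  have hR : ((∑ i, Real.logb 2 (N / A (f i))) / N + (∑ i, Real.logb 2 (N / B (g i))) / N) / 2 +
      1 - (∑ y ∈ univ.image f, min (A y) (B y)) / N =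
      ((∑ i, Real.logb 2 (N / A (f i))) + (∑ i, Real.logb 2 (N / B (g i))) + 2 * N -
        2 * ∑ y ∈ univ.image f, min (A y) (B y)) / (2 * N) := by
    field_simp
  rw [hR]
  exact div_le_div_of_nonneg_right hgoal (by positivity)

/-- **stub_mixture_entropy_le** (registered stub of the line, = `mixture_entropy_le` at `Type`):
the overlap upper bound `H(mix) ≤ (H f + H g)/2 + 1 - (∑_y min(|f⁻¹ y|, |g⁻¹ y|)) / N` for the
fair mixture of two maps on the same uniform sample space.
[J. Lin, IEEE Trans. Inform. Theory 37 (1991), Thm 3–4] [folklore] -/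
theorem stub_mixture_entropy_le {ι β : Type} [Fintype ι] [DecidableEq β] [Nonempty ι]
    (f g : ι → β) :
    mapEntropy (Finset.univ : Finset (Bool × ι)) (fun p => if p.1 then f p.2 else g p.2) ≤
      (mapEntropy Finset.univ f + mapEntropy Finset.univ g) / 2 + 1 -
        (∑ y ∈ Finset.univ.image f,
          (min (Finset.univ.filter fun i => f i = y).card
            (Finset.univ.filter fun i => g i = y).card : ℝ)) / Fintype.card ι :=
  mixture_entropy_le f g

end Summit.PneNP.PneNP.Cruxes.PeaThreeNotInP.SocketBP

end
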